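import Summits.BirchSwinnertonDyer.BirchSwinnertonDyer.Theorems.PrintCf2RubinValueTwoLinePinDefectEulerFactor
import Literature.NumberTheory.EllipticCurves.IwasawaAlgebraStructureProofs
import Literature.NumberTheory.EllipticCurves.IwasawaAlgebraCharIdealProofs
import Literature.NumberTheory.EllipticCurves.IwasawaAlgebraProofs
import Literature.NumberTheory.EllipticCurves.IwasawaAlgebraPseudoNullProofs
import Literature.NumberTheory.EllipticCurves.IwasawaAlgebraSpecializationIndexProofs
import Literature.NumberTheory.EllipticCurves.IwasawaAlgebraSpecializationFiniteKernelSeparationProofs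
import Literature.NumberTheory.EllipticCurves.IwasawaAlgebraGenericTwistFiniteProofs
import Literature.NumberTheory.EllipticCurves.IwasawaAlgebraInvolutionEvenLambdaProofs
import Literature.NumberTheory.EllipticCurves.IwasawaSelmerIsTorsionProofs
import HarnessLib

/-!
# M-LINE-PIN, (C2b) part 2: THE CHARACTERISTIC IDEAL OF A MODULE KILLED BY A PRIME OF `Λ` —
# `ch_Λ(X) = (π)^ℓ`, `λ(X) = ℓ · λ(Λ⧸(π))`; hence `ch_Λ(ker φ̄) = ((1+T) − u)^{λ(ker φ̄)}` for the `v̄`-defect module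

Cell `bsd-print-cf2`, width seat `bsd-line-cf2c-w8` g4 (prover-bsd-line-cf2c-w8-g4-0), planner g19's named piece M-LINE-PIN, step (C2b)
of the memo `Cruxes/TwoVariableMainConjAtSplitTwo/M-LINE-PIN-cf2c-w8g3.md` §2/§8, sequel of part 1 (p700499
`…LinePinDefectEulerFactor`: `((1+T)^n − u) • ker φ̄ = 0`). `--supports stmt-BirchSwinnertonDyer-24086 --as helper`, Theses-free.
HONEST FRAMING: §1 is generic commutative algebra over `Λ = ℤ_p⟦T⟧` (structure theorem bookkeeping); §2 applies it to the `v̄`-defect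
module `𝓓 = ker φ̄` of the `v`-line control identity (C5) in the case `n = 1` (a `τ ∈ D_{v̄}` with `κ τ = κ γ`, i.e. `v̄` UNDECOMPOSED in the
first slot's line — the case of `K = ℚ(√−7)`, `p = 2`, `v`-line, where `π̄ ≡ 3 (mod 8)` generates `ℤ₂ˣ⧸{±1}`): then
**`ch_Λ(𝓓) = ((1+T) − u)^{λ(𝓓)}`**, so «`ch_Λ(𝓓) = (E_v̄)`» ⟺ «`λ(𝓓) = 1`», which is where (LS)_v enters (as ONE number); the `ℤ_p`-corank
dictionary `λ(𝓓) = corank(H¹_nr(K̃_∞, M)^{γ₂=1} ⧸ im g)` and the corank count are NOT here. No summit statement is proved by this seat; BSD is not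
proved by any of this. THEOREMS ONLY (no definition, no named fact, no `sorry`).

WHAT.
* §1 `exists_charIdeal_eq_span_pow_of_prime_smul_eq_zero`: for a finitely generated torsion `Λ`-module `X` killed by a prime element `π` of `Λ`
  with `p ∤ π`: `∃ ℓ, ch_Λ(X) = (π)^ℓ ∧ λ(X) = ℓ · λ(Λ⧸(π))`. Proof: structure theorem `X ∼ E(μs, fs)` (`exists_isPseudoIsomorphism_elementary_holds`);
  `μ(X) = 0` (`X_{(p)} = 0` as `π ∉ (p)` kills `X`), so `μs = []`; the pseudo-isomorphism has finite cokernel, killed by some `p^a`, so `π p^a`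
  kills `E`, whence every elementary factor `f_j^{n_j}` divides `π p^a`, i.e. `n_j = 1` and `f_j ~ π`; then `ch = (∏ f_j) = (π)^ℓ`
  (`charIdeal_eq_span_holds`) and `λ(X) = Σ deg f_j = ℓ · λ(Λ⧸(π))` (`lambdaInvariant_eq_sum_natDegree_holds`, `finrank_quotient_pow`).
  Degree one: `charIdeal_eq_span_X_sub_C_pow_lambdaInvariant` — `(T − c) • X = 0`, `c ∈ 𝔪_{ℤ_p}` ⟹ `ch_Λ(X) = (T − c)^{λ(X)}`.
* §2 `charIdeal_ker_liftQ_eq_span_pow_lambdaInvariant`: in the setting of part 1 with `n = 1` (`κ τ = κ γ`) and `p ∣ 1 − u`: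
  `ch_Λ(ker φ̄) = ((1+T) − u)^{λ(ker φ̄)}`; and `ker φ̄ = ⊥` when `p ∤ 1 − u` (the Euler factor is a unit).
presearch: Washington §13.2 (Thm 13.12, Prop 13.8), NSW V §3 (structure theory), Greenberg–Vatsal 2000 Prop. (2.4) (the local factor
`𝒫_ℓ` computation, cyclotomic analogue) — tree theorems / assembly, no new fact. beyond-print theorem: no.

References: [Washington1997] §13.2; [NeukirchSchmidtWingberg2008] V §3; [GreenbergVatsal2000] §2 Prop. (2.4); [GreenbergLNM1716] §3–4.
-/

noncomputable section

open scoped Classical Pointwise Polynomial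

-- the summit namespace `Summit.BirchSwinnertonDyer.BirchSwinnertonDyer` repeats the problem name by design (D-0017)
set_option linter.dupNamespace false
set_option autoImplicit false

open Literature.NumberTheory.EllipticCurves Literature.NumberTheory.EllipticCurves.Module
  Literature.NumberTheory.EllipticCurves.IwasawaAlgebra

universe u

namespace Summit.BirchSwinnertonDyer.BirchSwinnertonDyer.Theorems.PrintCf2.LinePin

/-! ## §1. Finitely generated torsion `Λ`-modules killed by a prime element -/

section Algebra

variable {p : ℕ} [Fact p.Prime]

/-- A distinguished polynomial, viewed in `Λ`, does not divide `p^a` (it is not even a divisor of `p`: a prime divisor of the prime `p`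
would be an associate of `p`, but `p` divides no distinguished polynomial). [cite: Washington1997, §13.2] -/
theorem not_coe_dvd_C_p_pow_of_isDistinguishedAt {g : ℤ_[p][X]} (hg : g.IsDistinguishedAt (IsLocalRing.maximalIdeal ℤ_[p]))
    (hgp : Prime (g : IwasawaAlgebra p)) (a : ℕ) : ¬ (g : IwasawaAlgebra p) ∣ (PowerSeries.C (p : ℤ_[p]) : IwasawaAlgebra p) ^ a := by
  intro h
  have h1 : (g : IwasawaAlgebra p) ∣ PowerSeries.C (p : ℤ_[p]) := hgp.dvd_of_dvd_pow h
  have h2 : Associated (g : IwasawaAlgebra p) (PowerSeries.C (p : ℤ_[p])) := hgp.associated_of_dvd (prime_C p) h1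
  exact coe_notMem_augIdealP_of_isDistinguishedAt p hg
    (by rw [augIdealP, Ideal.mem_span_singleton]; exact h2.symm.dvd)

/-- For a finitely generated `Λ`-module killed by an element `s ∉ (p)`, `μ = 0` (`X_{(p)} = 0`). [cite: Washington1997, §13.2] -/
theorem muInvariant_eq_zero_of_smul_eq_zero_of_notMem (X : Type*) [AddCommGroup X] [Module (IwasawaAlgebra p) X]
    {s : IwasawaAlgebra p} (hs : s ∉ augIdealP p) (hsX : ∀ x : X, s • x = 0) : muInvariant p X = 0 := by
  rw [muInvariant_eq_toNat_lengthAt p X ⟨augIdealP p, isPrime_augIdealP_holds p⟩ rfl,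
    lengthAt_eq_zero_of_isTorsionBy (fun x ↦ hsX x) _ hs]
  rfl

/-- **`λ(Λ⧸(g)) = deg g`** for a distinguished polynomial `g` (`Λ⧸(g)` is `ℤ_p`-free of rank `deg g`, Weierstrass division).
[cite: Washington1997, Prop. 13.8] -/
theorem lambdaInvariant_quotient_span_coe_eq_natDegree {g : ℤ_[p][X]} (hg : g.IsDistinguishedAt (IsLocalRing.maximalIdeal ℤ_[p])) :
    lambdaInvariant p (IwasawaAlgebra p ⧸ Ideal.span {(g : IwasawaAlgebra p)}) = g.natDegree := by
  have hfree := free_quotient_pow p hg 1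
  have hrank := finrank_quotient_pow p hg 1
  rw [pow_one] at hfree hrank
  rw [one_mul] at hrank
  haveI := hfree
  rw [lambdaInvariant_eq_finrank_tensorProduct, Module.finrank_baseChange, hrank]

/-- List bookkeeping: if every `(g, m)` in `fs` has `m = 1` and `g ~ π` in `Λ`, then `∏ g^m ~ π^{#fs}`. [folklore] -/
theorem prod_map_pow_associated_pow_length {fs : List (ℤ_[p][X] × ℕ)} {π : IwasawaAlgebra p}
    (hfac : ∀ f ∈ fs, f.2 = 1 ∧ Associated ((f.1 : IwasawaAlgebra p)) π) :
    Associated (fs.map fun f ↦ ((f.1 : IwasawaAlgebra p)) ^ f.2).prod (π ^ fs.length) := by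
  induction fs with
  | nil => simp
  | cons f fs ih =>
    rw [List.map_cons, List.prod_cons, List.length_cons, pow_succ']
    obtain ⟨hm1, hassoc⟩ := hfac f List.mem_cons_self
    rw [hm1, pow_one]
    exact hassoc.mul_mul (ih fun g hg ↦ hfac g (List.mem_cons_of_mem _ hg))

/-- **STRUCTURE OF A MODULE KILLED BY A PRIME.** `X` a finitely generated torsion `Λ`-module, `π ∈ Λ` a prime element not dividing any
power of `p` (e.g. an irreducible distinguished polynomial), `π • X = 0`. Then there is `ℓ : ℕ` with
**`ch_Λ(X) = (π)^ℓ`** and **`λ(X) = ℓ · λ(Λ⧸(π))`** (by the structure theorem: the elementary model of `X` is `(Λ⧸(π))^ℓ`, since its finite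
cokernel is killed by some `p^a` and every elementary factor divides `π p^a`). [cite: Washington1997, §13.2 (Thm. 13.12, Prop. 13.8)]
[cite: NeukirchSchmidtWingberg2008, V §3] -/
theorem exists_charIdeal_eq_span_pow_of_prime_smul_eq_zero (X : Type*) [AddCommGroup X] [Module (IwasawaAlgebra p) X]
    [Module.Finite (IwasawaAlgebra p) X] (htors : Module.IsTorsion (IwasawaAlgebra p) X)
    {π : IwasawaAlgebra p} (hπ : Prime π) (hπp : ∀ a : ℕ, ¬ π ∣ (PowerSeries.C (p : ℤ_[p]) : IwasawaAlgebra p) ^ a)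
    (hπX : ∀ x : X, π • x = 0) :
    ∃ ℓ : ℕ, charIdeal (IwasawaAlgebra p) X = Ideal.span {π} ^ ℓ ∧
      lambdaInvariant p X = ℓ * lambdaInvariant p (IwasawaAlgebra p ⧸ Ideal.span {π}) := by
  obtain ⟨μs, fs, hμs, hfs, hApi⟩ := exists_isPseudoIsomorphism_elementary_holds p X htors
  have hfs' : ∀ f ∈ fs, f.1.IsDistinguishedAt (IsLocalRing.maximalIdeal ℤ_[p]) := fun f hf ↦ (hfs f hf).1
  have hchar := charIdeal_eq_span_holds p X hfs' hApi
  have hlam := lambdaInvariant_eq_sum_natDegree_holds p X hfs' hApi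
  -- `μ = 0`: `π ∉ (p)` kills `X`
  have hπmem : π ∉ augIdealP p := by
    intro h
    rw [augIdealP, Ideal.mem_span_singleton] at h
    -- `p ∣ π`, both prime ⟹ associated ⟹ `π ∣ p`
    exact hπp 1 (by rw [pow_one]; exact ((prime_C p).associated_of_dvd hπ h).symm.dvd)
  have hμ0 : μs.sum = 0 := by
    rw [← muInvariant_eq_sum_holds p X hfs' hApi]
    exact muInvariant_eq_zero_of_smul_eq_zero_of_notMem X hπmem hπX
  -- the pseudo-isomorphism and its finite cokernel
  obtain ⟨ψ, -, hcok⟩ := hApi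
  haveI : Module.Finite (IwasawaAlgebra p) (elementaryModule p μs fs) := moduleFinite_elementaryModule p μs fs
  haveI : Finite (elementaryModule p μs fs ⧸ LinearMap.range ψ) := finite_of_isPseudoNull p _ hcok
  obtain ⟨a, ha⟩ := exists_natCast_pow_smul_eq_zero_of_finite p (F := elementaryModule p μs fs ⧸ LinearMap.range ψ)
  have hkill : ∀ e : elementaryModule p μs fs, (π * (p : IwasawaAlgebra p) ^ a) • e = 0 := by
    intro e
    have h1 : ((p : IwasawaAlgebra p) ^ a) • e ∈ LinearMap.range ψ := by
      rw [← Submodule.Quotient.mk_eq_zero, Submodule.Quotient.mk_smul]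
      exact ha _
    obtain ⟨x, hx⟩ := h1
    rw [mul_smul, ← hx, ← map_smul, hπX, map_zero]
  -- every elementary factor `(g, m)` has `m = 1` and `g ~ π`
  have hfac : ∀ f ∈ fs, f.2 = 1 ∧ Associated ((f.1 : IwasawaAlgebra p)) π := by
    intro f hf
    obtain ⟨j, hj⟩ := List.mem_iff_get.mp hf
    have hgdist : (fs.get j).1.IsDistinguishedAt (IsLocalRing.maximalIdeal ℤ_[p]) := (hfs _ (List.get_mem fs j)).1
    have hgirr : Irreducible (fs.get j).1 := (hfs _ (List.get_mem fs j)).2.1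
    have hm : 0 < (fs.get j).2 := (hfs _ (List.get_mem fs j)).2.2
    -- `g` is prime in `Λ` (Weierstrass division: `Λ⧸(g) ≅ ℤ_p[X]⧸(g)`)
    have hgprimePoly : Prime (fs.get j).1 := hgirr.prime
    have hg0 : ((fs.get j).1 : IwasawaAlgebra p) ≠ 0 := fun h ↦ hgprimePoly.ne_zero (by exact_mod_cast h)
    haveI := (Ideal.span_singleton_prime hgprimePoly.ne_zero).mpr hgprimePoly
    have hgprime : Prime ((fs.get j).1 : IwasawaAlgebra p) :=
      (Ideal.span_singleton_prime hg0).mp (span_coe_isPrime_of_dvd hgdist (dvd_refl _))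
    -- `g^m ∣ π p^a`
    have hdvd : ((fs.get j).1 : IwasawaAlgebra p) ^ (fs.get j).2 ∣ π * (p : IwasawaAlgebra p) ^ a := by
      have h := hkill ((0, DirectSum.of (fun j : Fin fs.length ↦
        IwasawaAlgebra p ⧸ Ideal.span {((fs.get j).1 : IwasawaAlgebra p) ^ (fs.get j).2}) j (Ideal.Quotient.mk _ 1)) :
          elementaryModule p μs fs)
      have h2 : (π * (p : IwasawaAlgebra p) ^ a) • DirectSum.of (fun j : Fin fs.length ↦
          IwasawaAlgebra p ⧸ Ideal.span {((fs.get j).1 : IwasawaAlgebra p) ^ (fs.get j).2}) j (Ideal.Quotient.mk _ 1) = 0 :=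
        congrArg Prod.snd h
      rw [← DirectSum.of_smul] at h2
      have h3 : (π * (p : IwasawaAlgebra p) ^ a) •
          (Ideal.Quotient.mk (Ideal.span {((fs.get j).1 : IwasawaAlgebra p) ^ (fs.get j).2}) 1) = 0 :=
        DirectSum.of_injective j (h2.trans (map_zero _).symm)
      rw [show (π * (p : IwasawaAlgebra p) ^ a) •
          (Ideal.Quotient.mk (Ideal.span {((fs.get j).1 : IwasawaAlgebra p) ^ (fs.get j).2}) 1) =
          Ideal.Quotient.mk _ ((π * (p : IwasawaAlgebra p) ^ a) * 1) from rfl, mul_one,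
        Ideal.Quotient.eq_zero_iff_mem, Ideal.mem_span_singleton] at h3
      exact h3
    -- `g ∤ p^a`, so `g^m ∣ π`
    have hp' : ((p : ℕ) : IwasawaAlgebra p) = PowerSeries.C (p : ℤ_[p]) := by rw [map_natCast]
    have hgp : ¬ ((fs.get j).1 : IwasawaAlgebra p) ∣ (p : IwasawaAlgebra p) ^ a := by
      rw [hp']; exact not_coe_dvd_C_p_pow_of_isDistinguishedAt hgdist hgprime a
    have hdvdπ : ((fs.get j).1 : IwasawaAlgebra p) ^ (fs.get j).2 ∣ π := hgprime.pow_dvd_of_dvd_mul_right _ hgp hdvd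
    -- `m = 1` (π is irreducible and `g` is not a unit) and `g ~ π`
    have hgπ : ((fs.get j).1 : IwasawaAlgebra p) ∣ π := (dvd_pow_self _ hm.ne').trans hdvdπ
    have hassoc : Associated ((fs.get j).1 : IwasawaAlgebra p) π := hgprime.associated_of_dvd hπ hgπ
    have hm1 : (fs.get j).2 = 1 := by
      by_contra hne
      have h2 : 2 ≤ (fs.get j).2 := by omega
      obtain ⟨c, hc⟩ := hdvdπ
      have hsq : ((fs.get j).1 : IwasawaAlgebra p) ^ 2 ∣ π :=
        ⟨((fs.get j).1 : IwasawaAlgebra p) ^ ((fs.get j).2 - 2) * c, by rw [hc, ← mul_assoc, ← pow_add, Nat.add_sub_cancel' h2]⟩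
      obtain ⟨d, hd⟩ := hsq
      have hd' : π = ((fs.get j).1 : IwasawaAlgebra p) * (((fs.get j).1 : IwasawaAlgebra p) * d) := by
        rw [hd, pow_two, mul_assoc]
      rcases hπ.irreducible.isUnit_or_isUnit hd' with hu | hu
      · exact hgprime.not_unit hu
      · exact hgprime.not_unit (isUnit_of_mul_isUnit_left hu)
    rw [hj] at hm1 hassoc
    exact ⟨hm1, hassoc⟩
  refine ⟨fs.length, ?_, ?_⟩
  · -- `ch(X) = (charElement) = (∏ g_j) = (π)^ℓ`
    rw [hchar, Ideal.span_singleton_pow]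
    apply Ideal.span_singleton_eq_span_singleton.mpr
    unfold charElement
    rw [hμ0, pow_zero, map_one, one_mul]
    exact prod_map_pow_associated_pow_length hfac
  · -- `λ(X) = Σ deg g_j = ℓ · λ(Λ⧸(π))`
    rw [hlam]
    have hterm : ∀ f ∈ fs, f.2 * f.1.natDegree = lambdaInvariant p (IwasawaAlgebra p ⧸ Ideal.span {π}) := by
      intro f hf
      obtain ⟨hm1, hassoc⟩ := hfac f hf
      rw [hm1, one_mul, ← lambdaInvariant_quotient_span_coe_eq_natDegree (hfs' f hf)]
      exact lambdaInvariant_eq_of_linearEquiv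
        (Submodule.quotEquivOfEq _ _ (Ideal.span_singleton_eq_span_singleton.mpr hassoc))
    rw [List.map_congr_left hterm, List.map_const', List.sum_replicate, smul_eq_mul]

/-- **Degree one: `(T − c) • X = 0`, `c ∈ 𝔪_{ℤ_p}` ⟹ `ch_Λ(X) = (T − c)^{λ(X)}`** for a finitely generated torsion `Λ`-module `X`
(`T − c` is prime with `λ(Λ⧸(T − c)) = 1`). [cite: Washington1997, §13.2] -/
theorem charIdeal_eq_span_X_sub_C_pow_lambdaInvariant (X : Type*) [AddCommGroup X] [Module (IwasawaAlgebra p) X]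
    [Module.Finite (IwasawaAlgebra p) X] (htors : Module.IsTorsion (IwasawaAlgebra p) X)
    {c : ℤ_[p]} (hc : c ∈ IsLocalRing.maximalIdeal ℤ_[p]) (hX : ∀ x : X, (PowerSeries.X - PowerSeries.C c : IwasawaAlgebra p) • x = 0) :
    charIdeal (IwasawaAlgebra p) X = Ideal.span {(PowerSeries.X - PowerSeries.C c : IwasawaAlgebra p)} ^ lambdaInvariant p X := by
  have hπ := prime_X_sub_C p hc
  have hcoe : ((Polynomial.X - Polynomial.C c : Polynomial ℤ_[p]) : IwasawaAlgebra p) = PowerSeries.X - PowerSeries.C c := by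
    rw [Polynomial.coe_sub, Polynomial.coe_X, Polynomial.coe_C]
  have hπp : ∀ a : ℕ, ¬ (PowerSeries.X - PowerSeries.C c : IwasawaAlgebra p) ∣ (PowerSeries.C (p : ℤ_[p]) : IwasawaAlgebra p) ^ a := by
    intro a
    rw [← hcoe]
    exact not_coe_dvd_C_p_pow_of_isDistinguishedAt (isDistinguishedAt_X_sub_C p hc) (by rw [hcoe]; exact hπ) a
  obtain ⟨ℓ, hch, hlam⟩ := exists_charIdeal_eq_span_pow_of_prime_smul_eq_zero X htors hπ hπp hX
  rw [lambdaInvariant_quotient_span_X_sub_C hc, mul_one] at hlam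
  rw [hch, hlam]

/-- `(1 + T) − u = T − (u − 1)` in `Λ`. [folklore] -/
theorem one_add_X_sub_intCast (u : ℤ) :
    ((1 : IwasawaAlgebra p) + PowerSeries.X) - (u : IwasawaAlgebra p) = PowerSeries.X - PowerSeries.C ((u : ℤ_[p]) - 1) := by
  rw [map_sub, map_intCast, map_one]
  ring

end Algebra

/-! ## §2. The `v̄`-defect module of M-LINE-PIN: `ch_Λ(ker φ̄) = ((1+T) − u)^{λ(ker φ̄)}` when `v̄` is undecomposed in the line -/

section Defect

open NumberField IsDedekindDomain Field Literature.NumberTheory.GaloisRepresentations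
  Literature.NumberTheory.EllipticCurves.GreenbergSelmer Literature.NumberTheory.EllipticCurves.GreenbergVatsal2000
  Literature.NumberTheory.EllipticCurves.KellerYin2024

variable {K : Type u} [Field K] [NumberField K] {p : ℕ} [Fact p.Prime] {κ κ₂ : ZpExtension K p}
  {M : Type u} [AddCommGroup M] [DistribMulAction (absoluteGaloisGroup K) M] [TopologicalSpace M] [DiscreteTopology M]
  {𝔮 : HeightOneSpectrum (𝓞 K)} {γ γ₂ : absoluteGaloisGroup K}
  {g : unrSelmer κ M 𝔮 ∅ →+ unrSelmer₂ κ κ₂ M 𝔮}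
  (hg : ∀ t : unrSelmer κ M 𝔮 ∅,
    ((g t : unrSelmer₂ κ κ₂ M 𝔮) : subgroupH1 (ZpExtension.pairKer κ κ₂) M) =
      resOfLe M (ZpExtension.pairKer_le_left κ κ₂) (t : subgroupH1 κ.kerSubgroup M))
  {D₂ : DualData₂ κ κ₂ M 𝔮 γ γ₂} {D₁ : DatumDualData κ γ M (Castella2018.AcSelmer.bdpData M p 𝔮) ∅}
  {φ : D₂.X →ₛₗ[PowerSeries.map (PowerSeries.constantCoeff (R := ℤ_[p]))] D₁.X}
  (hφ : ∀ (x : D₂.X) (t : unrSelmer κ M 𝔮 ∅), D₁.toDual (φ x) t = D₂.toDual x (g t))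
include hg hφ

/-- **`ch_Λ(𝓓) = ((1+T) − u)^{λ(𝓓)}` FOR THE `v̄`-DEFECT MODULE `𝓓 = ker φ̄`** of the `v`-line control identity (C5), when `v̄` is
UNDECOMPOSED in the first slot's line (`∃ τ ∈ D_𝔮` with `κ τ = κ γ`; e.g. `K = ℚ(√−7)`, `p = 2`, the line unramified outside `v`) and
`τ` acts on `M` as an integer `u ≡ 1 (mod p)` (`M = A_θ`, `p = 2`: `u = θ(τ) = ±1`): hypotheses as in part 1
(`euler_smul_eq_zero_of_liftQ_eq_zero`) plus `D₂.X` finitely generated over `Λ₂`. So «`ch_Λ(𝓓) = ((1+T) − u)`» — the `v̄`-Euler factor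
of M-LINE-PIN's (A) — holds IFF `λ(𝓓) = 1`, and `λ(𝓓)` is the `ℤ_p`-corank of the `v̄`-defect `H¹_nr(K̃_∞, M)^{γ₂=1} ⧸ im g` ((LS)_v).
[cite: GreenbergVatsal2000, §2 Prop. (2.4)] [cite: Washington1997, §13.2] [cite: GreenbergLNM1716, §3–4] -/
theorem charIdeal_ker_liftQ_eq_span_pow_lambdaInvariant [Module.Finite (IwasawaAlgebra₂ p) D₂.X]
    (hγ : ZpExtension.IsTopGeneratorPair κ κ₂ γ γ₂)
    (hcont : ∀ m : M, Continuous fun σ : absoluteGaloisGroup K ↦ σ • m) (hprim : ∀ m : M, ∃ k : ℕ, p ^ k • m = 0)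
    (hκ₂ : κ₂.IsUnramifiedOutside 𝔮) (h𝔮 : ((p : ℕ) : 𝓞 K) ∈ 𝔮.asIdeal)
    (hI : ∀ y : absoluteGaloisGroup K, y ∈ ZpExtension.pairKer κ κ₂ → y ∈ inertia 𝔮 → ∀ m : M, y • m = m)
    {τ : absoluteGaloisGroup K} (hτ : τ ∈ decomp 𝔮) (hκτ : κ τ = κ γ) {u : ℤ} (hu : ∀ m : M, τ • m = u • m)
    (hpu : (p : ℤ) ∣ u - 1) :
    letI : Module (IwasawaAlgebra p) (QuotSMulTop (PowerSeries.C (PowerSeries.X : IwasawaAlgebra p) : IwasawaAlgebra₂ p) D₂.X) :=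
      Module.compHom _ (PowerSeries.map (PowerSeries.C (R := ℤ_[p])))
    ∀ (φbar : QuotSMulTop (PowerSeries.C (PowerSeries.X : IwasawaAlgebra p) : IwasawaAlgebra₂ p) D₂.X →ₗ[IwasawaAlgebra p] D₁.X),
      (∀ x : D₂.X, φbar (Submodule.Quotient.mk x) = φ x) →
      charIdeal (IwasawaAlgebra p) (LinearMap.ker φbar) =
        Ideal.span {((1 : IwasawaAlgebra p) + PowerSeries.X) - (u : IwasawaAlgebra p)} ^
          lambdaInvariant p (LinearMap.ker φbar) := by
  intro φbar hφbar
  letI instQ : Module (IwasawaAlgebra p) (QuotSMulTop (PowerSeries.C (PowerSeries.X : IwasawaAlgebra p) : IwasawaAlgebra₂ p) D₂.X) :=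
    Module.compHom _ (PowerSeries.map (PowerSeries.C (R := ℤ_[p])))
  haveI : Module.Finite (IwasawaAlgebra p)
      (QuotSMulTop (PowerSeries.C (PowerSeries.X : IwasawaAlgebra p) : IwasawaAlgebra₂ p) D₂.X) :=
    LinePinControl.moduleFinite_quotSMulTop_inner D₂
  -- the annihilator from part 1, with `n = 1`
  have hann : ∀ q : LinearMap.ker φbar,
      (PowerSeries.X - PowerSeries.C ((u : ℤ_[p]) - 1) : IwasawaAlgebra p) • q = 0 := by
    intro q
    apply Subtype.ext
    rw [Submodule.coe_smul, Submodule.coe_zero, ← one_add_X_sub_intCast u, ← pow_one ((1 : IwasawaAlgebra p) + PowerSeries.X)]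
    exact LinePinControl.euler_smul_eq_zero_of_liftQ_eq_zero hg hφ hγ hcont hprim hκ₂ h𝔮 hI hτ (n := 1) (by rw [pow_one, hκτ]) hu
      φbar hφbar q (LinearMap.mem_ker.mp q.2)
  have hc : ((u : ℤ_[p]) - 1) ∈ IsLocalRing.maximalIdeal ℤ_[p] := by
    rw [PadicInt.maximalIdeal_eq_span_p, Ideal.mem_span_singleton]
    obtain ⟨k, hk⟩ := hpu
    exact ⟨(k : ℤ_[p]), by exact_mod_cast hk⟩
  have htors : Module.IsTorsion (IwasawaAlgebra p) (LinearMap.ker φbar) := fun {q} ↦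
    ⟨⟨_, mem_nonZeroDivisors_of_ne_zero (X_sub_C_ne_zero p ((u : ℤ_[p]) - 1))⟩, hann q⟩
  rw [one_add_X_sub_intCast u]
  exact charIdeal_eq_span_X_sub_C_pow_lambdaInvariant (LinearMap.ker φbar) htors hc hann

/-- **Hence `ch_Λ(𝓓) = ((1+T) − u)` as soon as `λ(𝓓) = 1`** — the form in which (LS)_v («the `v̄`-defect has `ℤ_p`-corank one») closes
(C2b) for an undecomposed `v̄`. [cite: GreenbergVatsal2000, §2 Prop. (2.4)] -/
theorem charIdeal_ker_liftQ_eq_span_of_lambdaInvariant_eq_one [Module.Finite (IwasawaAlgebra₂ p) D₂.X]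
    (hγ : ZpExtension.IsTopGeneratorPair κ κ₂ γ γ₂)
    (hcont : ∀ m : M, Continuous fun σ : absoluteGaloisGroup K ↦ σ • m) (hprim : ∀ m : M, ∃ k : ℕ, p ^ k • m = 0)
    (hκ₂ : κ₂.IsUnramifiedOutside 𝔮) (h𝔮 : ((p : ℕ) : 𝓞 K) ∈ 𝔮.asIdeal)
    (hI : ∀ y : absoluteGaloisGroup K, y ∈ ZpExtension.pairKer κ κ₂ → y ∈ inertia 𝔮 → ∀ m : M, y • m = m)
    {τ : absoluteGaloisGroup K} (hτ : τ ∈ decomp 𝔮) (hκτ : κ τ = κ γ) {u : ℤ} (hu : ∀ m : M, τ • m = u • m)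
    (hpu : (p : ℤ) ∣ u - 1) :
    letI : Module (IwasawaAlgebra p) (QuotSMulTop (PowerSeries.C (PowerSeries.X : IwasawaAlgebra p) : IwasawaAlgebra₂ p) D₂.X) :=
      Module.compHom _ (PowerSeries.map (PowerSeries.C (R := ℤ_[p])))
    ∀ (φbar : QuotSMulTop (PowerSeries.C (PowerSeries.X : IwasawaAlgebra p) : IwasawaAlgebra₂ p) D₂.X →ₗ[IwasawaAlgebra p] D₁.X),
      (∀ x : D₂.X, φbar (Submodule.Quotient.mk x) = φ x) →
      lambdaInvariant p (LinearMap.ker φbar) = 1 →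
      charIdeal (IwasawaAlgebra p) (LinearMap.ker φbar) =
        Ideal.span {((1 : IwasawaAlgebra p) + PowerSeries.X) - (u : IwasawaAlgebra p)} := by
  intro φbar hφbar hlam
  have h := charIdeal_ker_liftQ_eq_span_pow_lambdaInvariant hg hφ hγ hcont hprim hκ₂ h𝔮 hI hτ hκτ hu hpu φbar hφbar
  rw [hlam, pow_one] at h
  exact h

/-- **The degenerate case `u ≢ 1 (mod p)`: the Euler factor is a unit and the `v̄`-defect module VANISHES** (`ker φ̄ = ⊥`) — for `p` odd
and `θ(τ) = −1` there is no `v̄`-correction to the line control identity. [cite: GreenbergVatsal2000, §2 Prop. (2.4)] -/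
theorem ker_liftQ_eq_bot_of_not_dvd (hγ : ZpExtension.IsTopGeneratorPair κ κ₂ γ γ₂)
    (hcont : ∀ m : M, Continuous fun σ : absoluteGaloisGroup K ↦ σ • m) (hprim : ∀ m : M, ∃ k : ℕ, p ^ k • m = 0)
    (hκ₂ : κ₂.IsUnramifiedOutside 𝔮) (h𝔮 : ((p : ℕ) : 𝓞 K) ∈ 𝔮.asIdeal)
    (hI : ∀ y : absoluteGaloisGroup K, y ∈ ZpExtension.pairKer κ κ₂ → y ∈ inertia 𝔮 → ∀ m : M, y • m = m)
    {τ : absoluteGaloisGroup K} (hτ : τ ∈ decomp 𝔮) {n : ℕ} (hκτ : κ τ = κ (γ ^ n)) {u : ℤ} (hu : ∀ m : M, τ • m = u • m)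
    (hpu : ¬ (p : ℤ) ∣ u - 1) :
    letI : Module (IwasawaAlgebra p) (QuotSMulTop (PowerSeries.C (PowerSeries.X : IwasawaAlgebra p) : IwasawaAlgebra₂ p) D₂.X) :=
      Module.compHom _ (PowerSeries.map (PowerSeries.C (R := ℤ_[p])))
    ∀ (φbar : QuotSMulTop (PowerSeries.C (PowerSeries.X : IwasawaAlgebra p) : IwasawaAlgebra₂ p) D₂.X →ₗ[IwasawaAlgebra p] D₁.X),
      (∀ x : D₂.X, φbar (Submodule.Quotient.mk x) = φ x) → LinearMap.ker φbar = ⊥ := by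
  intro φbar hφbar
  letI instQ : Module (IwasawaAlgebra p) (QuotSMulTop (PowerSeries.C (PowerSeries.X : IwasawaAlgebra p) : IwasawaAlgebra₂ p) D₂.X) :=
    Module.compHom _ (PowerSeries.map (PowerSeries.C (R := ℤ_[p])))
  -- the Euler factor has unit constant coefficient `1 − u`
  have hunit : IsUnit ((((1 : IwasawaAlgebra p) + PowerSeries.X) ^ n - (u : IwasawaAlgebra p))) := by
    rw [PowerSeries.isUnit_iff_constantCoeff, map_sub, map_pow, map_add, map_one, PowerSeries.constantCoeff_X, add_zero, one_pow,
      map_intCast]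
    have h1 : ((1 : ℤ_[p]) - (u : ℤ_[p])) = ((1 - u : ℤ) : ℤ_[p]) := by push_cast; ring
    rw [h1, PadicInt.isUnit_iff]
    have hnlt : ¬ ‖((1 - u : ℤ) : ℤ_[p])‖ < 1 := fun h ↦
      hpu (dvd_sub_comm.mp ((PadicInt.norm_int_lt_one_iff_dvd _).mp h))
    exact le_antisymm (PadicInt.norm_le_one _) (not_lt.mp hnlt)
  rw [eq_bot_iff]
  intro q hq
  have h0 := LinePinControl.euler_smul_eq_zero_of_liftQ_eq_zero hg hφ hγ hcont hprim hκ₂ h𝔮 hI hτ hκτ hu φbar hφbar q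
    (LinearMap.mem_ker.mp hq)
  rw [Submodule.mem_bot]
  obtain ⟨w, hw⟩ := hunit
  have : (↑w⁻¹ : IwasawaAlgebra p) • ((((1 : IwasawaAlgebra p) + PowerSeries.X) ^ n - (u : IwasawaAlgebra p)) • q) = q := by
    rw [← hw, smul_smul, Units.inv_mul, one_smul]
  rw [← this, h0, smul_zero]

end Defect

end Summit.BirchSwinnertonDyer.BirchSwinnertonDyer.Theorems.PrintCf2.LinePin

end
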